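import Literature.Analysis.FluidPDE.PeriodicCylinderWithinCalculus
import Literature.Analysis.FluidPDE.Ferrari1993EnergyIdentity
import HarnessLib

/-!
# Tangential regularity of the Neumann problem on the period cell of the cylinder

Topic `Literature/Analysis/FluidPDE`. Second file of the discharge of the pressure estimate
`Ferrari1993_periodicCylinderPressureEstimate` (`Ferrari1993EnergyInequalityReduction.lean`; A. B.
Ferrari, Comm. Math. Phys. **155** (1993), Lemma 2, pp. 280–281: `|∇p|_{H^s} ≤ C|u|_{W^{1,∞}}|u|_{H^s}`
from the Neumann problem (10)–(12), `Δp = −Σ∂ᵢuⱼ∂ⱼuᵢ` in `Ω`, `∂p/∂n = −Σuᵢuⱼψᵢⱼ` on `∂Ω`, "a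
standard estimate of `∇p`, derived by the usual method of choosing a partition of unity for `Ω`,
deriving local estimates from (10) and (12), and combining them"). In the periodic cylinder the
boundary need not be flattened: the wall `{r = 1}` is invariant under the two **tangential Killing
fields** `J = x₀∂₁ − x₁∂₀` (`∂_θ`) and `e₂` (`∂_z`), and the tangential part of the `H^s` estimate is
obtained by differentiating the problem along words in them. This file proves it, for every order at
once (`cellL2_cylGrad_tanWord_le`): for `q`, `G` smooth on the closed cylinder and `L`-periodic with
the Neumann relation `∂_{x_h} q = G` on the wall (`∂_{x_h} = r∂_r`), and every nonempty tangential
word `β = Z :: β'`,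

  `‖∇ Z^β q‖_{L²(cell)} ≤ ‖Z^{β'} Δq‖_{L²(cell)} + 2‖∇ Z^{β'} G‖_{L²(cell)} + 2‖Z^{β'} G‖_{L²(cell)}`.

Ingredients (all proved; calculus from `PeriodicCylinderWithinCalculus.lean`):

* the **energy identity** of the Neumann problem (`setIntegral_norm_cylGrad_sq_eq`):
  `∫‖∇q‖² = ∫ G ∂_{x_h}q − ∫ qΔq + ∫ q∂_{x_h}G + 2∫ qG` — Gauss–Green on the cell
  (`setIntegral_divergence_cylinderCell_eq_zero`) for the field `q(∇q − G x_h)`, which is tangential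
  on the wall exactly by the Neumann relation (`e_r = x_h`, `div x_h = 2` there);
* `Z^β q`, `Z^β G` satisfy the Neumann relation again: tangential words commute with `∂_{x_h}`
  (`cylDeriv_horizontalProj_cylWord_tanWord`) and annihilate functions vanishing on the wall
  (`cylWord_tanWord_eq_zero_of_wall`); and `Δ Z^β q = Z^β Δq` (`cylLap_cylWord_tanWord`);
* in each right-hand term one letter `Z` is integrated by parts onto the other factor
  (`setIntegral_cylDeriv_tanField_mul`: `∫(∂_Z f)g = −∫ f ∂_Z g`), and `|∂_Z f|, |∂_{x_h} f| ≤ ‖∇f‖`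
  on the closed cylinder (`r ≤ 1`); Cauchy–Schwarz. No Poincaré inequality and no induction on the
  order are needed: the estimate is linear in the data at every order.

Also: the real `L²(cell)` size `cellL2` (`toReal` of the tree's `eLpNorm`) with monotonicity,
triangle inequality and Cauchy–Schwarz for functions continuous on the closed cylinder, and the
bridges `cylBasis_eq_stdVec`, `cylBasis_two_eq_eZ` to the tree's standard basis (review note on
`PeriodicCylinderWithinCalculus`).

Not here: normal derivatives (from `r²Δ_h = ∂_{x_h}² + ∂_J²` and the equation), interior
estimates, the data of the Euler pressure and the assembly of the named fact — sequel files.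

Mathlib/tree search: no Neumann-problem estimates on domains in Mathlib or the tree
(`lean search 'Neumann.*estimate|neumann_energy'`: torus/whole-space only); `L²` bookkeeping reuses
`integral_norm_sq_eq_toReal_eLpNorm_two_sq`, `abs_integral_inner_le`,
`memLp_two_cylinderCell_of_continuousOn` (`Ferrari1993EnergyIdentity`).
-/

noncomputable section

open MeasureTheory Set Function Filter Topology TopologicalSpace WithLp
open scoped ContDiff NNReal ENNReal InnerProductSpace RealInnerProductSpace

namespace Literature.Analysis.FluidPDE

/-- Local notation for physical space `ℝ³ = EuclideanSpace ℝ (Fin 3)`. -/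
local notation "ℝ³" => EuclideanSpace ℝ (Fin 3)

/-- Local notation for the closed unit cylinder `{r ≤ 1}`. -/
local notation "𝕂" => closure (SetLike.coe unitCylinder : Set (EuclideanSpace ℝ (Fin 3)))

/-! ### Bridges to the tree's standard basis -/

/-- `cylBasis` is the tree's `stdVec` (same definition). [folklore] -/
theorem cylBasis_eq_stdVec (i : Fin 3) : cylBasis i = (stdVec i : ℝ³) := rfl

/-- `cylBasis 2` is the tree's axial unit vector `eZ`. [folklore] -/
theorem cylBasis_two_eq_eZ : cylBasis 2 = eZ := rfl

/-! ## FILE B: Tangential estimates for the Neumann problem on the period cell -/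

section NeumannTangential

variable {F' : Type*} [NormedAddCommGroup F'] [NormedSpace ℝ F']

/-! ### The real `L²(cell)` size -/

/-- The `L²` norm on the period cell as a real number (`toReal` of the tree's `eLpNorm`; finite for
functions continuous on the closed cylinder). [folklore] -/
def cellL2 (L : ℝ) (f : ℝ³ → F') : ℝ := (eLpNorm f 2 (volume.restrict (cylinderCell L : Set ℝ³))).toReal

omit [NormedSpace ℝ F'] in
/-- `cellL2` is nonnegative. [folklore] -/
theorem cellL2_nonneg (L : ℝ) (f : ℝ³ → F') : 0 ≤ cellL2 L f := ENNReal.toReal_nonneg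

/-- For `f` continuous on the closed cylinder, `∫_cell ‖f‖² = (cellL2 f)²`. [folklore] -/
theorem integral_norm_sq_eq_cellL2_sq (L : ℝ) {f : ℝ³ → F'} (hf : ContinuousOn f 𝕂) :
    ∫ x in (cylinderCell L : Set ℝ³), ‖f x‖ ^ 2 = cellL2 L f ^ 2 :=
  integral_norm_sq_eq_toReal_eLpNorm_two_sq (memLp_two_cylinderCell_of_continuousOn L hf)

omit [NormedSpace ℝ F'] in
/-- **Monotonicity**: a pointwise bound `‖f‖ ≤ ‖g‖` on the cell gives `cellL2 f ≤ cellL2 g` (for `g`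
continuous on the closed cylinder). [folklore] -/
theorem cellL2_mono {G' : Type*} [NormedAddCommGroup G'] (L : ℝ) {f : ℝ³ → F'} {g : ℝ³ → G'}
    (hg : ContinuousOn g 𝕂) (h : ∀ x ∈ (cylinderCell L : Set ℝ³), ‖f x‖ ≤ ‖g x‖) :
    cellL2 L f ≤ cellL2 L g := by
  refine ENNReal.toReal_mono (memLp_two_cylinderCell_of_continuousOn L hg).eLpNorm_ne_top ?_
  exact eLpNorm_mono_ae ((ae_restrict_iff' (cylinderCell L).isOpen.measurableSet).2
    (Eventually.of_forall h))

/-- `cellL2 (c f) = |c| cellL2 f`. [folklore] -/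
theorem cellL2_const_smul (L : ℝ) (c : ℝ) (f : ℝ³ → F') :
    cellL2 L (fun x => c • f x) = |c| * cellL2 L f := by
  rw [cellL2, show (fun x => c • f x) = c • f from rfl, eLpNorm_const_smul, ENNReal.toReal_mul,
    Real.enorm_eq_ofReal_abs, ENNReal.toReal_ofReal (abs_nonneg c)]
  rfl

omit [NormedSpace ℝ F'] in
/-- **Triangle inequality** for functions continuous on the closed cylinder. [folklore] -/
theorem cellL2_add_le (L : ℝ) {f g : ℝ³ → F'} (hf : ContinuousOn f 𝕂) (hg : ContinuousOn g 𝕂) :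
    cellL2 L (fun x => f x + g x) ≤ cellL2 L f + cellL2 L g := by
  have hfm := memLp_two_cylinderCell_of_continuousOn L hf
  have hgm := memLp_two_cylinderCell_of_continuousOn L hg
  rw [cellL2, cellL2, cellL2, ← ENNReal.toReal_add hfm.eLpNorm_ne_top hgm.eLpNorm_ne_top]
  refine ENNReal.toReal_mono (ENNReal.add_ne_top.2 ⟨hfm.eLpNorm_ne_top, hgm.eLpNorm_ne_top⟩) ?_
  exact eLpNorm_add_le hfm.1 hgm.1 (by norm_num)

/-- **Cauchy–Schwarz on the cell** for real functions continuous on the closed cylinder: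
`|∫_cell f g| ≤ cellL2 f · cellL2 g`. [folklore] -/
theorem abs_setIntegral_mul_le_cellL2 (L : ℝ) {f g : ℝ³ → ℝ} (hf : ContinuousOn f 𝕂)
    (hg : ContinuousOn g 𝕂) :
    |∫ x in (cylinderCell L : Set ℝ³), f x * g x| ≤ cellL2 L f * cellL2 L g := by
  have h := abs_integral_inner_le (memLp_two_cylinderCell_of_continuousOn L hf)
    (memLp_two_cylinderCell_of_continuousOn L hg)
  simp only [RCLike.inner_apply, conj_trivial] at h
  rw [cellL2, cellL2]
  simpa only [mul_comm] using h

/-- A pointwise bound by a product `‖f‖ ≤ ‖a‖ ‖b‖`... the scalar Cauchy–Schwarz with a pointwise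
dominated first factor: `|∫ f g| ≤ cellL2 a · cellL2 g` if `|f| ≤ ‖a‖` on the cell. [folklore] -/
theorem abs_setIntegral_mul_le_cellL2_of_le {G' : Type*} [NormedAddCommGroup G'] (L : ℝ)
    {f g : ℝ³ → ℝ} {a : ℝ³ → G'} (hf : ContinuousOn f 𝕂) (hg : ContinuousOn g 𝕂)
    (ha : ContinuousOn a 𝕂) (hfa : ∀ x ∈ (cylinderCell L : Set ℝ³), |f x| ≤ ‖a x‖) :
    |∫ x in (cylinderCell L : Set ℝ³), f x * g x| ≤ cellL2 L a * cellL2 L g :=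
  (abs_setIntegral_mul_le_cellL2 L hf hg).trans (mul_le_mul_of_nonneg_right
    (cellL2_mono L ha fun x hx => by simpa using hfa x hx) (cellL2_nonneg L g))

/-! ### The tangential fields and words -/

/-- The two tangential Killing fields of the cylinder: the rotation generator `J` (`true`) and the
axial direction `e₂` (`false`). [folklore] -/
def tanField : Bool → ℝ³ → ℝ³
  | true => rotGen
  | false => fun _ => cylBasis 2

/-- The list of fields of a tangential word. [folklore] -/
def tanWord (β : List Bool) : List (ℝ³ → ℝ³) := β.map tanField

/-- Unfolding `tanWord` on a cons. [folklore] -/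
@[simp] theorem tanWord_cons (b : Bool) (β : List Bool) : tanWord (b :: β) = tanField b :: tanWord β := rfl

/-- Unfolding `tanWord []`. [folklore] -/
@[simp] theorem tanWord_nil : tanWord [] = [] := rfl

/-- The tangential fields are smooth. [folklore] -/
theorem contDiff_tanField : ∀ b : Bool, ContDiff ℝ ∞ (tanField b)
  | true => contDiff_rotGen
  | false => contDiff_const

/-- All fields of a tangential word are smooth. [folklore] -/
theorem contDiff_of_mem_tanWord {β : List Bool} {V : ℝ³ → ℝ³} (hV : V ∈ tanWord β) : ContDiff ℝ ∞ V := by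
  obtain ⟨b, -, rfl⟩ := List.mem_map.1 hV
  exact contDiff_tanField b

/-- The tangential fields are invariant under the axial translation. [folklore] -/
theorem tanField_add_axialShift (L : ℝ) : ∀ (b : Bool) (x : ℝ³),
    tanField b (x + L • EuclideanSpace.single (2 : Fin 3) (1 : ℝ)) = tanField b x
  | true, x => rotGen_add_axialShift x L
  | false, _ => rfl

/-- The tangential fields are tangent to the wall: `V x = a J x + b e₂`. [folklore] -/
theorem tanField_eq_combination : ∀ (b : Bool) (x : ℝ³), ∃ a c : ℝ, tanField b x = a • rotGen x + c • cylBasis 2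
  | true, x => ⟨1, 0, by simp [tanField]⟩
  | false, x => ⟨0, 1, by simp [tanField]⟩

/-- Word derivatives along tangential words of functions smooth on the closed cylinder are smooth
there. [folklore] -/
theorem contDiffOn_cylWord_tanWord (β : List Bool) {f : ℝ³ → F'} (hf : ContDiffOn ℝ ∞ f 𝕂) :
    ContDiffOn ℝ ∞ (cylWord (tanWord β) f) 𝕂 :=
  contDiffOn_cylWord (fun _ hV => contDiff_of_mem_tanWord hV) hf

/-- Word derivatives along tangential words of periodic functions are periodic. [folklore] -/
theorem IsAxiallyPeriodic.cylWord_tanWord {L : ℝ} (β : List Bool) {f : ℝ³ → F'}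
    (hf : IsAxiallyPeriodic L f) :
    IsAxiallyPeriodic L (_root_.Literature.Analysis.FluidPDE.cylWord (tanWord β) f) :=
  hf.cylWord fun V hV x => by
    obtain ⟨b, -, rfl⟩ := List.mem_map.1 hV
    exact tanField_add_axialShift L b x

/-- The gradient within of a periodic function is periodic. [folklore] -/
theorem IsAxiallyPeriodic.cylGrad {L : ℝ} {f : ℝ³ → ℝ} (hf : IsAxiallyPeriodic L f) :
    IsAxiallyPeriodic L (_root_.Literature.Analysis.FluidPDE.cylGrad f) := fun x => by
  simp only [cylGrad_apply]
  refine Finset.sum_congr rfl fun i _ => ?_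
  rw [(hf.cylDeriv (V := fun _ => cylBasis i) (fun _ => rfl)) x]

/-- The Laplacian within of a periodic function is periodic. [folklore] -/
theorem IsAxiallyPeriodic.cylLap {L : ℝ} {f : ℝ³ → F'} (hf : IsAxiallyPeriodic L f) :
    IsAxiallyPeriodic L (_root_.Literature.Analysis.FluidPDE.cylLap f) := fun x => by
  simp only [cylLap_apply]
  refine Finset.sum_congr rfl fun i _ => ?_
  rw [((hf.cylDeriv (V := fun _ => cylBasis i) (fun _ => rfl)).cylDeriv
    (V := fun _ => cylBasis i) (fun _ => rfl)) x]

/-- `Z^β (f − g) = Z^β f − Z^β g` on the closed cylinder. [folklore] -/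
theorem cylWord_tanWord_sub (β : List Bool) {f g : ℝ³ → F'} (hf : ContDiffOn ℝ ∞ f 𝕂)
    (hg : ContDiffOn ℝ ∞ g 𝕂) :
    EqOn (cylWord (tanWord β) (fun y => f y - g y))
      (fun y => cylWord (tanWord β) f y - cylWord (tanWord β) g y) 𝕂 := by
  induction β with
  | nil => exact fun _ _ => rfl
  | cons b β ih =>
    intro x hx
    rw [tanWord_cons, cylWord_cons, cylWord_cons, cylWord_cons, cylDeriv_congr ih hx]
    exact cylDeriv_sub (contDiffOn_cylWord_tanWord β hf) (contDiffOn_cylWord_tanWord β hg) hx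

/-- **Tangential words of a function vanishing on the wall vanish on the wall.** [folklore] -/
theorem cylWord_tanWord_eq_zero_of_wall (β : List Bool) {f : ℝ³ → F'} (hf : ContDiffOn ℝ ∞ f 𝕂)
    (h0 : ∀ y ∈ frontier (unitCylinder : Set ℝ³), f y = 0) :
    ∀ x ∈ frontier (unitCylinder : Set ℝ³), cylWord (tanWord β) f x = 0 := by
  induction β with
  | nil => exact h0
  | cons b β ih =>
    intro x hx
    obtain ⟨a, c, hV⟩ := tanField_eq_combination b x
    rw [tanWord_cons, cylWord_cons]
    exact cylDeriv_eq_zero_of_wall_of_tangent (contDiffOn_cylWord_tanWord β hf) ih hx hV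

/-- **`∂_{x_h}` commutes with tangential words** on the closed cylinder. [folklore] -/
theorem cylDeriv_horizontalProj_cylWord_tanWord (β : List Bool) {f : ℝ³ → F'} (hf : ContDiffOn ℝ ∞ f 𝕂) :
    EqOn (cylDeriv (fun y => horizontalProj y) (cylWord (tanWord β) f))
      (cylWord (tanWord β) (cylDeriv (fun y => horizontalProj y) f)) 𝕂 := by
  induction β with
  | nil => exact fun _ _ => rfl
  | cons b β ih =>
    intro x hx
    rw [tanWord_cons, cylWord_cons, cylWord_cons]
    have hW := contDiffOn_cylWord_tanWord β hf
    have step : cylDeriv (fun y => horizontalProj y) (cylDeriv (tanField b) (cylWord (tanWord β) f)) x =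
        cylDeriv (tanField b) (cylDeriv (fun y => horizontalProj y) (cylWord (tanWord β) f)) x := by
      cases b with
      | true => exact (cylDeriv_rotGen_horizontalProj_comm hW hx).symm
      | false => exact cylDeriv_horizontalProj_cylBasis_two_comm hW hx
    rw [step]
    exact cylDeriv_congr ih hx

/-- **The Laplacian within commutes with tangential words** on the closed cylinder. [folklore] -/
theorem cylLap_cylWord_tanWord (β : List Bool) {f : ℝ³ → F'} (hf : ContDiffOn ℝ ∞ f 𝕂) :
    EqOn (cylLap (cylWord (tanWord β) f)) (cylWord (tanWord β) (cylLap f)) 𝕂 := by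
  induction β with
  | nil => exact fun _ _ => rfl
  | cons b β ih =>
    intro x hx
    rw [tanWord_cons, cylWord_cons, cylWord_cons]
    have hW := contDiffOn_cylWord_tanWord β hf
    have step : cylLap (cylDeriv (tanField b) (cylWord (tanWord β) f)) x =
        cylDeriv (tanField b) (cylLap (cylWord (tanWord β) f)) x := by
      cases b with
      | true => exact cylLap_cylDeriv_rotGen hW hx
      | false => exact cylLap_cylDeriv_const hW _ hx
    rw [step]
    exact cylDeriv_congr ih hx

/-- `∫_cell ∂_Z f = 0` for the tangential fields. [folklore] -/
theorem setIntegral_cylDeriv_tanField_eq_zero {L : ℝ} (hL : 0 < L) (b : Bool) {φ : ℝ³ → ℝ}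
    (hφ : ContDiffOn ℝ ∞ φ 𝕂) (hφp : IsAxiallyPeriodic L φ) :
    ∫ x in (cylinderCell L : Set ℝ³), cylDeriv (tanField b) φ x = 0 := by
  cases b with
  | true => exact setIntegral_cylDeriv_rotGen_eq_zero hL (hφ.of_le (by exact_mod_cast le_top)) hφp
  | false => exact setIntegral_cylDeriv_cylBasis_two_eq_zero hL (hφ.of_le (by exact_mod_cast le_top)) hφp

/-- **Integration by parts for the tangential fields**: `∫_cell (∂_Z f) g = −∫_cell f (∂_Z g)`. [folklore] -/
theorem setIntegral_cylDeriv_tanField_mul {L : ℝ} (hL : 0 < L) (b : Bool) {f g : ℝ³ → ℝ}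
    (hf : ContDiffOn ℝ ∞ f 𝕂) (hg : ContDiffOn ℝ ∞ g 𝕂) (hfp : IsAxiallyPeriodic L f)
    (hgp : IsAxiallyPeriodic L g) :
    ∫ x in (cylinderCell L : Set ℝ³), cylDeriv (tanField b) f x * g x =
      -∫ x in (cylinderCell L : Set ℝ³), f x * cylDeriv (tanField b) g x :=
  setIntegral_cylDeriv_mul_eq_neg (contDiff_tanField b)
    (fun _ hh hhp => setIntegral_cylDeriv_tanField_eq_zero hL b hh hhp) hf hg hfp hgp

/-- On the closed cylinder, `|∂_Z g| ≤ ‖∇_K g‖` for the tangential fields. [folklore] -/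
theorem abs_cylDeriv_tanField_le (b : Bool) (g : ℝ³ → ℝ) {x : ℝ³} (hx : x ∈ 𝕂) :
    |cylDeriv (tanField b) g x| ≤ ‖cylGrad g x‖ := by
  rw [← Real.norm_eq_abs, norm_cylGrad]
  cases b with
  | true => exact norm_cylDeriv_rotGen_le g hx
  | false => exact norm_cylDeriv_cylBasis_le 2 g x

/-- On the closed cylinder, `|∂_{x_h} g| ≤ ‖∇_K g‖`. [folklore] -/
theorem abs_cylDeriv_horizontalProj_le (g : ℝ³ → ℝ) {x : ℝ³} (hx : x ∈ 𝕂) :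
    |cylDeriv (fun y => horizontalProj y) g x| ≤ ‖cylGrad g x‖ := by
  rw [← Real.norm_eq_abs, norm_cylGrad]
  exact norm_cylDeriv_horizontalProj_le g hx

/-! ### The energy identity of the Neumann problem -/

/-- `div x_h = 2`. [folklore] -/
theorem divergence_horizontalProj (x : ℝ³) :
    VectorCalculus.divergence (fun y : ℝ³ => horizontalProj y) x = 2 := by
  rw [divergence_eq_sum_fderiv_single, fderiv_horizontalProj]
  simp [Fin.sum_univ_three, horizontalProj_apply_eq]
  norm_num

/-- On the wall, `e_r = x_h`. [folklore] -/
theorem eR_eq_horizontalProj_of_wall {x : ℝ³} (hx : x ∈ frontier (unitCylinder : Set ℝ³)) :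
    eR x = horizontalProj x := by
  rw [frontier_unitCylinder] at hx
  rw [eR, show cylRadius x = 1 from hx, inv_one, one_smul]
  rfl

/-- On the wall, `⟪x_h, x_h⟫ = 1`. [folklore] -/
theorem inner_horizontalProj_self_of_wall {x : ℝ³} (hx : x ∈ frontier (unitCylinder : Set ℝ³)) :
    ⟪horizontalProj x, horizontalProj x⟫ = (1 : ℝ) := by
  rw [frontier_unitCylinder] at hx
  rw [real_inner_self_eq_norm_sq, norm_horizontalProj, show cylRadius x = 1 from hx, one_pow]

/-- **The energy identity of the Neumann problem on the period cell.** For `q` and `G` smooth on the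
closed cylinder and `L`-periodic, with the Neumann relation `∂_{x_h} q = G` on the wall `{r = 1}`
(`∂_{x_h} = r∂_r = ∂_r` there),
`∫_cell ‖∇q‖² = ∫_cell G ∂_{x_h}q − ∫_cell q Δq + ∫_cell q ∂_{x_h}G + 2 ∫_cell q G`:
Gauss–Green on the cell for the field `q (∇q − G x_h)`, which is tangential on the wall precisely by
the Neumann relation, with `div x_h = 2` (Ferrari 1993, the `H^s` estimate of `∇p` from (10)–(12),
p. 281; Kato–Lai 1984 §4). [folklore] -/
theorem setIntegral_norm_cylGrad_sq_eq {L : ℝ} (hL : 0 < L) {q G : ℝ³ → ℝ}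
    (hq : ContDiffOn ℝ ∞ q 𝕂) (hG : ContDiffOn ℝ ∞ G 𝕂) (hqp : IsAxiallyPeriodic L q)
    (hGp : IsAxiallyPeriodic L G)
    (hN : ∀ x ∈ frontier (unitCylinder : Set ℝ³), cylDeriv (fun y => horizontalProj y) q x = G x) :
    ∫ x in (cylinderCell L : Set ℝ³), ‖cylGrad q x‖ ^ 2 =
      (∫ x in (cylinderCell L : Set ℝ³), G x * cylDeriv (fun y => horizontalProj y) q x) -
      (∫ x in (cylinderCell L : Set ℝ³), q x * cylLap q x) +
      (∫ x in (cylinderCell L : Set ℝ³), q x * cylDeriv (fun y => horizontalProj y) G x) +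
      2 * ∫ x in (cylinderCell L : Set ℝ³), q x * G x := by
  set Ω : Set ℝ³ := (cylinderCell L : Set ℝ³) with hΩ
  -- the flux field
  set Y : ℝ³ → ℝ³ := fun y => cylGrad q y - G y • horizontalProj y with hY
  set W : ℝ³ → ℝ³ := fun y => q y • Y y with hW
  have hYs : ContDiffOn ℝ ∞ Y 𝕂 := (contDiffOn_cylGrad hq).sub (hG.smul contDiff_horizontalProj.contDiffOn)
  have hWs : ContDiffOn ℝ ∞ W 𝕂 := hq.smul hYs
  have hW1 : ContDiffOn ℝ 1 W 𝕂 := hWs.of_le (by exact_mod_cast le_top)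
  -- tangential on the wall by the Neumann relation
  have hslip : ∀ x ∈ frontier (unitCylinder : Set ℝ³), ⟪W x, eR x⟫ = 0 := by
    intro x hx
    simp only [hW, hY, inner_smul_left, inner_sub_left, RCLike.conj_to_real,
      eR_eq_horizontalProj_of_wall hx, inner_cylGrad_eq_cylDeriv q (fun y => horizontalProj y) x,
      hN x hx, inner_horizontalProj_self_of_wall hx]
    ring
  -- periodic
  have hper : IsAxiallyPeriodic L W := by
    intro x
    simp only [hW, hY, hqp x, hGp x, hqp.cylGrad x, horizontalProj_add_axialShift]
  have hflux := setIntegral_divergence_cylinderCell_eq_zero hL hW1 hslip hper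
  -- the divergence on the cell
  have hdiv : ∀ x ∈ Ω, VectorCalculus.divergence W x =
      ‖cylGrad q x‖ ^ 2 - G x * cylDeriv (fun y => horizontalProj y) q x +
      (q x * cylLap q x - q x * cylDeriv (fun y => horizontalProj y) G x - 2 * (q x * G x)) := by
    intro x hx
    have hxU : cylRadius x < 1 := cylinderCell_le_unitCylinder L hx
    have hxU' : x ∈ (unitCylinder : Set ℝ³) := hxU
    have hxK : x ∈ 𝕂 := subset_closure hxU'
    have dq : DifferentiableAt ℝ q x := differentiableAt_of_contDiffOn_closure (hq.of_le (by exact_mod_cast le_top)) hxU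
    have dG : DifferentiableAt ℝ G x := differentiableAt_of_contDiffOn_closure (hG.of_le (by exact_mod_cast le_top)) hxU
    have dY : DifferentiableAt ℝ Y x := differentiableAt_of_contDiffOn_closure (hYs.of_le (by exact_mod_cast le_top)) hxU
    have dgr : DifferentiableAt ℝ (cylGrad q) x :=
      differentiableAt_of_contDiffOn_closure ((contDiffOn_cylGrad hq).of_le (by exact_mod_cast le_top)) hxU
    have dhP : DifferentiableAt ℝ (fun y : ℝ³ => horizontalProj y) x := horizontalProjL.differentiableAt
    have hgradq : gradient q x = cylGrad q x := (cylGrad_eq_gradient q hxU').symm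
    have hdivY : VectorCalculus.divergence Y x =
        cylLap q x - (G x * 2 + cylDeriv (fun y => horizontalProj y) G x) := by
      have dGh : DifferentiableAt ℝ (fun y => G y • horizontalProj y) x := dG.smul dhP
      rw [hY, divergence_sub_apply dgr dGh, ← cylDiv_eq_divergence _ hxU',
        cylDiv_cylGrad hq hxK, divergence_smul_apply dG dhP, divergence_horizontalProj,
        inner_gradient_eq_fderiv, ← cylDeriv_eq_fderiv (fun y => horizontalProj y) G hxU']
    rw [hW, divergence_smul_apply dq dY, hdivY, hgradq]
    simp only [hY, inner_sub_left, inner_smul_left, RCLike.conj_to_real, real_inner_self_eq_norm_sq]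
    rw [real_inner_comm, inner_cylGrad_eq_cylDeriv]
    ring
  rw [setIntegral_congr_fun (cylinderCell L).isOpen.measurableSet hdiv] at hflux
  -- integrability of the pieces
  have cq : ContinuousOn q 𝕂 := hq.continuousOn
  have cG : ContinuousOn G 𝕂 := hG.continuousOn
  have cgr : ContinuousOn (cylGrad q) 𝕂 := (contDiffOn_cylGrad hq).continuousOn
  have cRq : ContinuousOn (cylDeriv (fun y => horizontalProj y) q) 𝕂 :=
    (contDiffOn_cylDeriv contDiff_horizontalProj hq).continuousOn
  have cRG : ContinuousOn (cylDeriv (fun y => horizontalProj y) G) 𝕂 :=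
    (contDiffOn_cylDeriv contDiff_horizontalProj hG).continuousOn
  have cL : ContinuousOn (cylLap q) 𝕂 := (contDiffOn_cylLap hq).continuousOn
  have i1 : IntegrableOn (fun x => ‖cylGrad q x‖ ^ 2) Ω volume :=
    integrableOn_cylinderCell_of_continuousOn_K L (cgr.norm.pow 2)
  have i2 : IntegrableOn (fun x => G x * cylDeriv (fun y => horizontalProj y) q x) Ω volume :=
    integrableOn_cylinderCell_of_continuousOn_K L (cG.mul cRq)
  have i3 : IntegrableOn (fun x => q x * cylLap q x) Ω volume :=
    integrableOn_cylinderCell_of_continuousOn_K L (cq.mul cL)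
  have i4 : IntegrableOn (fun x => q x * cylDeriv (fun y => horizontalProj y) G x) Ω volume :=
    integrableOn_cylinderCell_of_continuousOn_K L (cq.mul cRG)
  have i5 : IntegrableOn (fun x => 2 * (q x * G x)) Ω volume :=
    integrableOn_cylinderCell_of_continuousOn_K L (continuousOn_const.mul (cq.mul cG))
  have i12 : IntegrableOn (fun x => ‖cylGrad q x‖ ^ 2 - G x * cylDeriv (fun y => horizontalProj y) q x)
      Ω volume := i1.sub i2
  have i34 : IntegrableOn (fun x => q x * cylLap q x - q x * cylDeriv (fun y => horizontalProj y) G x)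
      Ω volume := i3.sub i4
  have i345 : IntegrableOn (fun x => q x * cylLap q x - q x * cylDeriv (fun y => horizontalProj y) G x -
      2 * (q x * G x)) Ω volume := i34.sub i5
  have hflux' : ∫ x in Ω, (‖cylGrad q x‖ ^ 2 - G x * cylDeriv (fun y => horizontalProj y) q x +
      (q x * cylLap q x - q x * cylDeriv (fun y => horizontalProj y) G x - 2 * (q x * G x))) = 0 := hflux
  rw [integral_add i12 i345, integral_sub i1 i2, integral_sub i34 i5, integral_sub i3 i4,
    integral_const_mul] at hflux'
  linarith

/-! ### The tangential estimate -/

/-- **Tangential regularity of the Neumann problem, all orders at once.** Let `q`, `G` be smooth on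
the closed cylinder and `L`-periodic with `∂_{x_h} q = G` on the wall, and let `β = Z :: β'` be a
nonempty word in the tangential Killing fields `J`, `e₂`. Then, with `Z^β` the word derivative,
`‖∇ Z^β q‖_{L²(cell)} ≤ ‖Z^{β'} Δq‖_{L²(cell)} + 2 ‖∇ Z^{β'} G‖_{L²(cell)} + 2 ‖Z^{β'} G‖_{L²(cell)}`.
Proof: `Z^β q` and `Z^β G` again satisfy the Neumann relation (tangential words commute with
`∂_{x_h}` and annihilate functions vanishing on the wall) and `Δ Z^β q = Z^β Δ q`, so the energy
identity applies to them; in each of its four right-hand terms one letter `Z` is integrated by parts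
onto the other factor (`∫ (∂_Z f) g = −∫ f ∂_Z g`, the fields being tangential, periodic and
divergence free) and `|∂_Z f|, |∂_{x_h} f| ≤ ‖∇f‖` on the closed cylinder; Cauchy–Schwarz. This is the
tangential part of the `H^s`-estimate of the Neumann problem (10)–(12) of Ferrari 1993, p. 281 (there
by a partition of unity and flattening of the boundary). [cite: Ferrari1993, Lemma 2 pp. 280–281 (tangential derivatives)] -/
theorem cellL2_cylGrad_tanWord_le {L : ℝ} (hL : 0 < L) {q G : ℝ³ → ℝ}
    (hq : ContDiffOn ℝ ∞ q 𝕂) (hG : ContDiffOn ℝ ∞ G 𝕂) (hqp : IsAxiallyPeriodic L q)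
    (hGp : IsAxiallyPeriodic L G)
    (hN : ∀ x ∈ frontier (unitCylinder : Set ℝ³), cylDeriv (fun y => horizontalProj y) q x = G x)
    (b : Bool) (β : List Bool) :
    cellL2 L (cylGrad (cylWord (tanWord (b :: β)) q)) ≤
      cellL2 L (cylWord (tanWord β) (cylLap q)) + 2 * cellL2 L (cylGrad (cylWord (tanWord β) G)) +
        2 * cellL2 L (cylWord (tanWord β) G) := by
  set Ω : Set ℝ³ := (cylinderCell L : Set ℝ³) with hΩ
  -- the differentiated pair
  set qt : ℝ³ → ℝ := cylWord (tanWord (b :: β)) q with hqt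
  set Gt : ℝ³ → ℝ := cylWord (tanWord (b :: β)) G with hGt
  set q' : ℝ³ → ℝ := cylWord (tanWord β) q with hq'
  set G' : ℝ³ → ℝ := cylWord (tanWord β) G with hG'
  set F' : ℝ³ → ℝ := cylWord (tanWord β) (cylLap q) with hF'
  have hqt_def : qt = cylDeriv (tanField b) q' := rfl
  have hGt_def : Gt = cylDeriv (tanField b) G' := rfl
  have hq's : ContDiffOn ℝ ∞ q' 𝕂 := contDiffOn_cylWord_tanWord β hq
  have hG's : ContDiffOn ℝ ∞ G' 𝕂 := contDiffOn_cylWord_tanWord β hG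
  have hF's : ContDiffOn ℝ ∞ F' 𝕂 := contDiffOn_cylWord_tanWord β (contDiffOn_cylLap hq)
  have hqts : ContDiffOn ℝ ∞ qt 𝕂 := contDiffOn_cylWord_tanWord (b :: β) hq
  have hGts : ContDiffOn ℝ ∞ Gt 𝕂 := contDiffOn_cylWord_tanWord (b :: β) hG
  have hq'p : IsAxiallyPeriodic L q' := hqp.cylWord_tanWord β
  have hG'p : IsAxiallyPeriodic L G' := hGp.cylWord_tanWord β
  have hF'p : IsAxiallyPeriodic L F' := hqp.cylLap.cylWord_tanWord β
  have hqtp : IsAxiallyPeriodic L qt := hqp.cylWord_tanWord (b :: β)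
  have hGtp : IsAxiallyPeriodic L Gt := hGp.cylWord_tanWord (b :: β)
  have hKΩ : ∀ {x : ℝ³}, x ∈ Ω → x ∈ 𝕂 := fun hx => subset_closure (cylinderCell_le_unitCylinder L hx)
  -- the Neumann relation for the pair
  have hNt : ∀ x ∈ frontier (unitCylinder : Set ℝ³), cylDeriv (fun y => horizontalProj y) qt x = Gt x := by
    intro x hx
    have hxK : x ∈ 𝕂 := frontier_subset_K hx
    rw [hqt, cylDeriv_horizontalProj_cylWord_tanWord (b :: β) hq hxK]
    have hRq := contDiffOn_cylDeriv (F := ℝ) contDiff_horizontalProj hq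
    have h0 := cylWord_tanWord_eq_zero_of_wall (b :: β) (hRq.sub hG) (fun y hy => by
        show cylDeriv (fun y => horizontalProj y) q y - G y = 0
        rw [hN y hy, sub_self]) x hx
    rw [cylWord_tanWord_sub (b :: β) hRq hG hxK] at h0
    exact sub_eq_zero.1 h0
  -- the energy identity for the pair
  have hE := setIntegral_norm_cylGrad_sq_eq hL hqts hGts hqtp hGtp hNt
  -- `Δ qt = Z F'` and `∂_{x_h} Gt = Z ∂_{x_h} G'` on the cell; `Gt = Z G'` by definition
  have hLap : ∀ x ∈ Ω, qt x * cylLap qt x = qt x * cylDeriv (tanField b) F' x := by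
    intro x hx
    rw [hqt, cylLap_cylWord_tanWord (b :: β) hq (hKΩ hx)]
    rfl
  have hRG : ∀ x ∈ Ω, qt x * cylDeriv (fun y => horizontalProj y) Gt x =
      qt x * cylDeriv (tanField b) (cylDeriv (fun y => horizontalProj y) G') x := by
    intro x hx
    congr 1
    rw [hGt_def]
    cases b with
    | true => exact (cylDeriv_rotGen_horizontalProj_comm hG's (hKΩ hx)).symm
    | false => exact cylDeriv_horizontalProj_cylBasis_two_comm hG's (hKΩ hx)
  rw [setIntegral_congr_fun (cylinderCell L).isOpen.measurableSet hLap,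
    setIntegral_congr_fun (cylinderCell L).isOpen.measurableSet hRG] at hE
  -- continuity facts
  have cqt : ContinuousOn qt 𝕂 := hqts.continuousOn
  have cG' : ContinuousOn G' 𝕂 := hG's.continuousOn
  have cF'c : ContinuousOn F' 𝕂 := hF's.continuousOn
  have cgr : ContinuousOn (cylGrad qt) 𝕂 := (contDiffOn_cylGrad hqts).continuousOn
  have cgrG : ContinuousOn (cylGrad G') 𝕂 := (contDiffOn_cylGrad hG's).continuousOn
  have hRG's : ContDiffOn ℝ ∞ (cylDeriv (fun y => horizontalProj y) G') 𝕂 :=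
    contDiffOn_cylDeriv contDiff_horizontalProj hG's
  have cZqt : ContinuousOn (cylDeriv (tanField b) qt) 𝕂 :=
    (contDiffOn_cylDeriv (contDiff_tanField b) hqts).continuousOn
  have cRqt : ContinuousOn (cylDeriv (fun y => horizontalProj y) qt) 𝕂 :=
    (contDiffOn_cylDeriv contDiff_horizontalProj hqts).continuousOn
  -- the four terms
  set a : ℝ := cellL2 L (cylGrad qt) with ha
  have ha0 : 0 ≤ a := cellL2_nonneg L _
  have hsq : ∫ x in Ω, ‖cylGrad qt x‖ ^ 2 = a ^ 2 := integral_norm_sq_eq_cellL2_sq L cgr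
  -- T1
  have T1 : |∫ x in Ω, Gt x * cylDeriv (fun y => horizontalProj y) qt x| ≤ cellL2 L (cylGrad G') * a := by
    have e : ∫ x in Ω, Gt x * cylDeriv (fun y => horizontalProj y) qt x =
        ∫ x in Ω, cylDeriv (fun y => horizontalProj y) qt x * Gt x :=
      integral_congr_ae (Eventually.of_forall fun x => mul_comm _ _)
    rw [e]
    refine (abs_setIntegral_mul_le_cellL2_of_le L cRqt hGts.continuousOn cgr
      fun x hx => abs_cylDeriv_horizontalProj_le qt (hKΩ hx)).trans ?_
    rw [mul_comm]
    refine mul_le_mul_of_nonneg_right (cellL2_mono L cgrG fun x hx => ?_) ha0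
    rw [hGt_def, Real.norm_eq_abs]
    exact abs_cylDeriv_tanField_le b G' (hKΩ hx)
  -- T2
  have T2 : |∫ x in Ω, qt x * cylDeriv (tanField b) F' x| ≤ a * cellL2 L F' := by
    have e : ∫ x in Ω, qt x * cylDeriv (tanField b) F' x = -∫ x in Ω, cylDeriv (tanField b) qt x * F' x := by
      rw [setIntegral_cylDeriv_tanField_mul hL b hqts hF's hqtp hF'p]
      simp_rw [mul_comm (qt _)]
      rw [neg_neg]
    rw [e, abs_neg]
    exact abs_setIntegral_mul_le_cellL2_of_le L cZqt cF'c cgr fun x hx => abs_cylDeriv_tanField_le b qt (hKΩ hx)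
  -- T3
  have T3 : |∫ x in Ω, qt x * cylDeriv (tanField b) (cylDeriv (fun y => horizontalProj y) G') x| ≤
      a * cellL2 L (cylGrad G') := by
    have e : ∫ x in Ω, qt x * cylDeriv (tanField b) (cylDeriv (fun y => horizontalProj y) G') x =
        -∫ x in Ω, cylDeriv (tanField b) qt x * cylDeriv (fun y => horizontalProj y) G' x := by
      rw [setIntegral_cylDeriv_tanField_mul hL b hqts hRG's hqtp (hG'p.cylDeriv fun x =>
        horizontalProj_add_axialShift x L)]
      simp_rw [mul_comm (qt _)]
      rw [neg_neg]
    rw [e, abs_neg]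
    refine (abs_setIntegral_mul_le_cellL2_of_le L cZqt hRG's.continuousOn cgr fun x hx =>
      abs_cylDeriv_tanField_le b qt (hKΩ hx)).trans ?_
    refine mul_le_mul_of_nonneg_left (cellL2_mono L cgrG fun x hx => ?_) ha0
    rw [Real.norm_eq_abs]
    exact abs_cylDeriv_horizontalProj_le G' (hKΩ hx)
  -- T4
  have T4 : |∫ x in Ω, qt x * Gt x| ≤ a * cellL2 L G' := by
    have e : ∫ x in Ω, qt x * Gt x = -∫ x in Ω, cylDeriv (tanField b) qt x * G' x := by
      rw [hGt_def, setIntegral_cylDeriv_tanField_mul hL b hqts hG's hqtp hG'p]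
      simp_rw [mul_comm (qt _)]
      rw [neg_neg]
    rw [e, abs_neg]
    exact abs_setIntegral_mul_le_cellL2_of_le L cZqt cG' cgr fun x hx => abs_cylDeriv_tanField_le b qt (hKΩ hx)
  -- assemble: `a² ≤ a · R`
  set R : ℝ := cellL2 L F' + 2 * cellL2 L (cylGrad G') + 2 * cellL2 L G' with hR
  have hR0 : 0 ≤ R := by
    have := cellL2_nonneg L F'; have := cellL2_nonneg L (cylGrad G'); have := cellL2_nonneg L G'
    positivity
  have key : a ^ 2 ≤ a * R := by
    rw [← hsq, hE, hR]
    have h1 := le_abs_self (∫ x in Ω, Gt x * cylDeriv (fun y => horizontalProj y) qt x)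
    have h2 := neg_abs_le (∫ x in Ω, qt x * cylDeriv (tanField b) F' x)
    have h3 := le_abs_self (∫ x in Ω, qt x * cylDeriv (tanField b) (cylDeriv (fun y => horizontalProj y) G') x)
    have h4 := le_abs_self (∫ x in Ω, qt x * Gt x)
    nlinarith [T1, T2, T3, T4, ha0, cellL2_nonneg L (cylGrad G')]
  show a ≤ R
  by_cases ha' : a = 0
  · rw [ha']; exact hR0
  · have hapos : 0 < a := lt_of_le_of_ne ha0 (Ne.symm ha')
    nlinarith

end NeumannTangential

end Literature.Analysis.FluidPDE
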